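import Mathlib.LinearAlgebra.Matrix.Rank
import Mathlib.LinearAlgebra.FiniteDimensional.Lemmas
import Literature.NumberTheory.Transcendental.AxSchanuel
import Literature.NumberTheory.Transcendental.AxSchanuelProofs
import Literature.NumberTheory.Transcendental.RosenlichtProp4Residues
import HarnessLib

/-!
# Ax's theorem (Ax 1971, Thm. 3) for fields in every universe

Trunk T-TRANSCEND (`Literature/NumberTheory/Transcendental`). The named fact
`Literature.NumberTheory.Transcendental.ax_schanuel` (`AxSchanuel.lean`; J. Ax, *On Schanuel's
conjectures*, Ann. of Math. 93 (1971), Thm. 3, finite families of derivations, with the rank term)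
quantifies over fields `K : Type`, and so does its proof `ax_schanuel_holds`
(`RosenlichtProp4Residues.lean`, through `ax_schanuel_of_rosenlicht` of `AxSchanuelProofs.lean`,
whose steps 2–3 are stated for `k K : Type` because their input is the universe-`0` named fact
`Rosenlicht.Rosenlicht1976_prop4`). The transcendence input itself is proved in all universes:
`Rosenlicht.Rosenlicht1976_prop4_mp` (`k K : Type*`). This file re-runs steps 2–4 of
`AxSchanuelProofs.lean` verbatim on that polymorphic input and obtains **Ax's Theorem 3 for fields
`K : Type u` in any universe** (`Ax1971.add_rank_le_trdeg`), which is what the discharge of Kirby's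
weak Schanuel property `Kirby2010_weakSchanuel K` for `K : Type*` (`EclWeakSchanuelProofs.lean`)
consumes. No statement of an existing declaration is touched; the proofs are those of
`linearIndependent_dlog_sub_D`, `ax_schanuel_of_field`, `ax_schanuel_of_rosenlicht` with the single
line invoking `h4 : Rosenlicht1976_prop4` replaced by `Rosenlicht.Rosenlicht1976_prop4_iff`.

## Contents (all proved)

* `Ax1971.linearIndependent_dlog_sub` — the forms `zᵢ⁻¹ dzᵢ - dyᵢ ∈ Ω[K⁄k]` are `K`-linearly
  independent (Rosenlicht 1976, proof of Thm. 1 and its Corollary; heart of Ax 1971 Thm. 3),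
  `k : Type u`, `K : Type v`.
* `Ax1971.add_rank_le_trdeg_of_field` — `n + rank (Dⱼ yᵢ) ≤ trdeg_k k[ȳ, z̄]` over a base field of
  constants (rank–nullity in `Ω[K⁄k]`).
* `Ax1971.add_rank_le_trdeg` — **Ax 1971, Thm. 3** over the constants `C = ⋂ ker Dⱼ` of a finite
  family of derivations of a field `K : Type u` of characteristic zero: the statement of
  `ax_schanuel` with `K` in an arbitrary universe.
* The universe-`0` instance of `Ax1971.add_rank_le_trdeg` is the named fact `ax_schanuel`
  (already `ax_schanuel_holds`; not restated here).

## References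

* J. Ax, *On Schanuel's conjectures*, Ann. of Math. 93 (1971), 252–268, Thm. 3.
* M. Rosenlicht, *On Liouville's theory of elementary functions*, Pacific J. Math. 65 (1976),
  485–492, Props. 2–6, Thm. 1 and its Corollary.
* J. Kirby, *Exponential algebraicity in exponential fields*, Bull. Lond. Math. Soc. 42 (2010),
  879–890, Thm. 5.1 (Ax's theorem as used there).
-/

noncomputable section

open KaehlerDifferential

universe u v

namespace Literature.NumberTheory.Transcendental.Ax1971

/-! ### Step 2 in all universes: the forms `dzᵢ/zᵢ - dyᵢ` are `K`-linearly independent -/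

section Field

variable {k : Type u} {K : Type v} [Field k] [CharZero k] [Field K] [CharZero K] [Algebra k K]
  {m n : ℕ}

/-- **Independence of the logarithmic forms**, fields in any universes (Rosenlicht 1976, proof of
Thm. 1 and of its Corollary, with Prop. 4 as input; the heart of Ax 1971, Thm. 3). Let `k ⊆ K` be
fields of characteristic zero and `D₁, …, D_m` `k`-derivations of `K` whose common constants are
exactly `k`; let `zᵢ ≠ 0`, `Dⱼ zᵢ = zᵢ Dⱼ yᵢ`, and suppose no non-trivial integer combination
`Σ qᵢ yᵢ` is a constant. Then the forms `zᵢ⁻¹ dzᵢ - dyᵢ ∈ Ω[K⁄k]` are linearly independent over `K`.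
This is `Transcendental.linearIndependent_dlog_sub_D` (fields in `Type`, input the named fact
`Rosenlicht1976_prop4`) with the input replaced by the proved, universe-polymorphic
`Rosenlicht.Rosenlicht1976_prop4_iff`; the proof is otherwise verbatim.
[cite: Rosenlicht1976, Thm. 1 and Corollary (proof)] -/
theorem linearIndependent_dlog_sub (D : Fin m → Derivation k K K)
    (hC : ∀ x : K, (∀ j, D j x = 0) → x ∈ Set.range (algebraMap k K))
    (y z : Fin n → K) (hz : ∀ i, z i ≠ 0) (hexp : ∀ j i, D j (z i) = z i * D j (y i))
    (hind : ∀ q : Fin n → ℤ, (∀ j, D j (∑ i, (q i : K) * y i) = 0) → q = 0) :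
    LinearIndependent K fun i => (z i)⁻¹ • KaehlerDifferential.D k K (z i) -
      KaehlerDifferential.D k K (y i) := by
  classical
  by_contra hdep
  obtain ⟨b, ⟨i₀, hi₀⟩, hbC, hrel⟩ := Rosenlicht.exists_const_relation_lieDeriv D _
    (fun j i => Rosenlicht.lieDeriv_dlog_sub_eq_zero (D j) (hz i) (hexp j i)) hdep
  -- the coefficients come from `k`
  choose b' hb' using fun i => hC (b i) (fun j => hbC j i)
  have hb'₀ : b' i₀ = 1 := (algebraMap k K).injective (by rw [hb', hi₀, map_one])
  -- a `ℚ`-basis of their span, and integer coordinates after clearing denominators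
  obtain ⟨κ, a, ha, hspan, hli⟩ := exists_linearIndependent' ℚ b'
  haveI : Fintype κ := Fintype.ofInjective a ha
  set c : κ → k := b' ∘ a with hc
  have hmem : ∀ i, b' i ∈ Submodule.span ℚ (Set.range c) := fun i => by
    rw [hc, hspan]; exact Submodule.subset_span ⟨i, rfl⟩
  obtain ⟨N, hN, hNmem⟩ := exists_common_nsmul_mem_span_int c b' hmem
  choose μ hμ using fun i => (Submodule.mem_span_range_iff_exists_fun ℤ).mp (hNmem i)
  -- `hμ i : ∑ l, μ i l • c l = (N : ℤ) • b' i`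
  have hNb : ∀ i, (N : K) * b i = ∑ l, (μ i l : K) * algebraMap k K (c l) := fun i => by
    have := congrArg (algebraMap k K) (hμ i)
    rw [map_sum, map_zsmul, hb', zsmul_eq_mul, Int.cast_natCast] at this
    rw [← this]
    exact Finset.sum_congr rfl fun l _ => by rw [map_zsmul, zsmul_eq_mul]
  -- the power products `w_l = Π zᵢ ^ μ_{il}`
  obtain ⟨w, hw⟩ : ∃ w : κ → K, ∀ l, w l = ∏ i, z i ^ μ i l := ⟨_, fun _ => rfl⟩
  have hw0 : ∀ l, w l ≠ 0 := fun l => by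
    rw [hw]; exact Finset.prod_ne_zero_iff.mpr fun i _ => zpow_ne_zero _ (hz i)
  have hdlog : ∀ l, (w l)⁻¹ • KaehlerDifferential.D k K (w l) =
      ∑ i, (μ i l : K) • ((z i)⁻¹ • KaehlerDifferential.D k K (z i)) := fun l => by
    have := Rosenlicht.dlog_prod_zpow (R := k) Finset.univ z (fun i _ => hz i) (fun i => μ i l)
    simp only [Rosenlicht.dlog_def] at this
    rw [hw, this]
    exact Finset.sum_congr rfl fun i _ => by rw [Int.cast_smul_eq_zsmul]
  -- the relation, rewritten: `Σ_l c_l dw_l/w_l + dv = 0` with `v = -Σ N bᵢ yᵢ`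
  set v : K := -∑ i, (N : K) * b i * y i with hv
  have hdv : KaehlerDifferential.D k K v =
      -∑ i, ((N : K) * b i) • KaehlerDifferential.D k K (y i) := by
    rw [hv, map_neg, map_sum]
    congr 1
    refine Finset.sum_congr rfl fun i _ => ?_
    have hconst : KaehlerDifferential.D k K ((N : K) * b i) = 0 := by
      rw [← hb', ← map_natCast (algebraMap k K), ← map_mul, Derivation.map_algebraMap]
    rw [Derivation.leibniz, hconst, smul_zero, add_zero]
  have hsum : (∑ l, algebraMap k K (c l) • (w l)⁻¹ • KaehlerDifferential.D k K (w l)) =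
      ∑ i, ((N : K) * b i) • ((z i)⁻¹ • KaehlerDifferential.D k K (z i)) := by
    calc (∑ l, algebraMap k K (c l) • (w l)⁻¹ • KaehlerDifferential.D k K (w l))
        = ∑ l, ∑ i, (algebraMap k K (c l) * (μ i l : K)) •
            ((z i)⁻¹ • KaehlerDifferential.D k K (z i)) := by
          refine Finset.sum_congr rfl fun l _ => ?_
          rw [hdlog, Finset.smul_sum]
          exact Finset.sum_congr rfl fun i _ => smul_smul _ _ _
      _ = ∑ i, ∑ l, (algebraMap k K (c l) * (μ i l : K)) •
            ((z i)⁻¹ • KaehlerDifferential.D k K (z i)) := Finset.sum_comm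
      _ = ∑ i, ((N : K) * b i) • ((z i)⁻¹ • KaehlerDifferential.D k K (z i)) := by
          refine Finset.sum_congr rfl fun i _ => ?_
          rw [← Finset.sum_smul, hNb, Finset.sum_congr rfl fun l _ =>
            mul_comm (algebraMap k K (c l)) ((μ i l : ℤ) : K)]
  have hrel' : (∑ l, algebraMap k K (c l) • (w l)⁻¹ • KaehlerDifferential.D k K (w l)) +
      KaehlerDifferential.D k K v = 0 := by
    rw [hsum, hdv, ← sub_eq_add_neg, ← Finset.sum_sub_distrib]
    have : ∑ i, (((N : K) * b i) • ((z i)⁻¹ • KaehlerDifferential.D k K (z i)) -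
        ((N : K) * b i) • KaehlerDifferential.D k K (y i)) =
        (N : K) • ∑ i, b i • ((z i)⁻¹ • KaehlerDifferential.D k K (z i) -
          KaehlerDifferential.D k K (y i)) := by
      rw [Finset.smul_sum]
      exact Finset.sum_congr rfl fun i _ => by simp only [smul_sub, smul_smul, mul_assoc]
    rw [this, hrel, smul_zero]
  -- Rosenlicht's Prop. 4 (proved, any universes; after reindexing by `Fin`): the `w_l` are
  -- algebraic over `k`
  have halg : ∀ l, IsAlgebraic k (w l) := by
    set e := Fintype.equivFin κ
    have hli' : LinearIndependent ℚ (c ∘ e.symm) := hli.comp _ e.symm.injective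
    have key := Rosenlicht.Rosenlicht1976_prop4_iff (c ∘ e.symm) hli' (w ∘ e.symm)
      (fun i => hw0 _) v
    have lhs : (∑ i, algebraMap k K ((c ∘ e.symm) i) • ((w ∘ e.symm) i)⁻¹ •
        KaehlerDifferential.D k K ((w ∘ e.symm) i)) =
        ∑ l, algebraMap k K (c l) • (w l)⁻¹ • KaehlerDifferential.D k K (w l) :=
      e.symm.sum_comp (fun l => algebraMap k K (c l) • (w l)⁻¹ • KaehlerDifferential.D k K (w l))
    have := (key.mp (by rw [lhs]; exact hrel')).1
    intro l
    simpa using this (e l)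
  -- hence the `Dⱼ` kill the `w_l`: the integer combinations `Σᵢ μ_{il} yᵢ` are constants
  have hμ0 : ∀ l, (fun i => μ i l) = 0 := by
    intro l
    apply hind
    intro j
    have h1 : D j (w l) = 0 := Rosenlicht.derivation_eq_zero_of_isAlgebraic (D j) (halg l)
    have h2 := inv_mul_derivation_prod_zpow (D j) Finset.univ z (fun i _ => hz i) (fun i => μ i l)
    rw [← hw, h1, mul_zero] at h2
    have h3 : ∀ i, D j ((μ i l : K) * y i) = (μ i l : K) * ((z i)⁻¹ * D j (z i)) := fun i => by
      rw [Derivation.leibniz, Derivation.map_intCast, smul_zero, add_zero, smul_eq_mul, hexp j i,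
        ← mul_assoc (z i)⁻¹, inv_mul_cancel₀ (hz i), one_mul]
    rw [map_sum, Finset.sum_congr rfl fun i _ => h3 i, ← h2]
  -- contradiction at `i₀`
  have h0 : ∑ l, μ i₀ l • c l = 0 :=
    Finset.sum_eq_zero fun l _ => by rw [show μ i₀ l = 0 from congrFun (hμ0 l) i₀, zero_smul]
  have := hμ i₀
  rw [h0, hb'₀, zsmul_one, Int.cast_natCast] at this
  exact hN (Nat.cast_eq_zero.mp this.symm)

/-! ### Step 3 in all universes: rank–nullity -/

/-- **Ax's theorem over a base field of constants**, fields in any universes (Ax 1971, Thm. 3, in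
the form of Kirby 2010, Thm. 5.1): for `k`-derivations `D₁, …, D_m` of `K` with common constants
exactly `k`, `zᵢ ≠ 0`, `Dⱼ zᵢ = zᵢ Dⱼ yᵢ`, and `ȳ` `ℚ`-linearly independent modulo the constants,
`n + rank (Dⱼ yᵢ)ᵢⱼ ≤ trdeg_k k[ȳ, z̄]`. Proof as in `Transcendental.ax_schanuel_of_field` (whose
fields live in `Type`): with `V = span_K {dyᵢ, dzᵢ} ⊆ Ω[K⁄k]` and `Φ = (Dⱼ*)ⱼ : V → Kᵐ`, the
independent forms `zᵢ⁻¹dzᵢ - dyᵢ` lie in `ker Φ` and the rows `(Dⱼ yᵢ)ⱼ = Φ(dyᵢ)` in `im Φ`, so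
`n + rank ≤ dim V ≤ trdeg` (`Rosenlicht.finrank_span_le_trdeg_adjoin`). [cite: Ax1971, Thm. 3] -/
theorem add_rank_le_trdeg_of_field (D : Fin m → Derivation k K K)
    (hC : ∀ x : K, (∀ j, D j x = 0) → x ∈ Set.range (algebraMap k K))
    (y z : Fin n → K) (hz : ∀ i, z i ≠ 0) (hexp : ∀ j i, D j (z i) = z i * D j (y i))
    (hind : ∀ q : Fin n → ℤ, (∀ j, D j (∑ i, (q i : K) * y i) = 0) → q = 0) :
    ((n + (Matrix.of fun i j => D j (y i)).rank : ℕ) : Cardinal) ≤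
      Algebra.trdeg k (Algebra.adjoin k (Set.range y ∪ Set.range z)) := by
  classical
  have hS : (Set.range y ∪ Set.range z).Finite := (Set.finite_range y).union (Set.finite_range z)
  set V : Submodule K (Ω[K⁄k]) :=
    Submodule.span K (KaehlerDifferential.D k K '' (Set.range y ∪ Set.range z)) with hV
  have hyV : ∀ i, KaehlerDifferential.D k K (y i) ∈ V := fun i =>
    Submodule.subset_span ⟨y i, Or.inl ⟨i, rfl⟩, rfl⟩
  have hzV : ∀ i, KaehlerDifferential.D k K (z i) ∈ V := fun i =>
    Submodule.subset_span ⟨z i, Or.inr ⟨i, rfl⟩, rfl⟩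
  haveI : FiniteDimensional K V := FiniteDimensional.span_of_finite K (hS.image _)
  -- the forms `θᵢ` and the map `Φ`
  set θ : Fin n → Ω[K⁄k] := fun i => (z i)⁻¹ • KaehlerDifferential.D k K (z i) -
    KaehlerDifferential.D k K (y i) with hθdef
  have hθV : ∀ i, θ i ∈ V := fun i => V.sub_mem (V.smul_mem _ (hzV i)) (hyV i)
  have hθ : LinearIndependent K θ := linearIndependent_dlog_sub D hC y z hz hexp hind
  set Φ : Ω[K⁄k] →ₗ[K] (Fin m → K) := LinearMap.pi fun j => (D j).liftKaehlerDifferential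
    with hΦdef
  have hΦD : ∀ x : K, Φ (KaehlerDifferential.D k K x) = fun j => D j x := fun x => by
    ext j
    simp [hΦdef, Derivation.liftKaehlerDifferential_comp_D]
  have hΦθ : ∀ i, Φ (θ i) = 0 := fun i => by
    ext j
    rw [hθdef, map_sub, map_smul, hΦD, hΦD]
    simp only [Pi.sub_apply, Pi.smul_apply, smul_eq_mul, Pi.zero_apply, hexp j i]
    rw [← mul_assoc, inv_mul_cancel₀ (hz i), one_mul, sub_self]
  set f : V →ₗ[K] (Fin m → K) := Φ.comp V.subtype with hf
  have hrn := LinearMap.finrank_range_add_finrank_ker f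
  -- `n ≤ dim ker`
  have h1 : n ≤ Module.finrank K (LinearMap.ker f) := by
    set θ' : Fin n → V := fun i => ⟨θ i, hθV i⟩ with hθ'
    have hθ'ind : LinearIndependent K θ' := LinearIndependent.of_comp V.subtype (by exact hθ)
    have hle : Submodule.span K (Set.range θ') ≤ LinearMap.ker f := by
      rw [Submodule.span_le]
      rintro _ ⟨i, rfl⟩
      simp only [SetLike.mem_coe, LinearMap.mem_ker, hf, LinearMap.comp_apply,
        Submodule.subtype_apply, hθ']
      exact hΦθ i
    calc n = Fintype.card (Fin n) := (Fintype.card_fin n).symm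
      _ = Module.finrank K (Submodule.span K (Set.range θ')) := (finrank_span_eq_card hθ'ind).symm
      _ ≤ Module.finrank K (LinearMap.ker f) := Submodule.finrank_mono hle
  -- `rank ≤ dim im`
  have h2 : (Matrix.of fun i j => D j (y i)).rank ≤ Module.finrank K (LinearMap.range f) := by
    rw [Matrix.rank_eq_finrank_span_row]
    apply Submodule.finrank_mono
    rw [Submodule.span_le]
    rintro _ ⟨i, rfl⟩
    refine ⟨⟨KaehlerDifferential.D k K (y i), hyV i⟩, ?_⟩
    rw [hf, LinearMap.comp_apply, Submodule.subtype_apply, hΦD]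
    rfl
  -- `dim V ≤ trdeg`
  have h3 := Rosenlicht.finrank_span_le_trdeg_adjoin (KaehlerDifferential.D k K)
    (Set.range y ∪ Set.range z) hS
  calc ((n + (Matrix.of fun i j => D j (y i)).rank : ℕ) : Cardinal)
      ≤ (Module.finrank K V : Cardinal) := by exact_mod_cast (by omega)
    _ ≤ _ := h3

end Field

/-! ### Step 4 in all universes: Ax's Theorem 3 over the constants of the family -/

/-- **Ax 1971, Theorem 3, for fields in any universe** (finite families of derivations, with the
rank term; the statement of the named fact `Transcendental.ax_schanuel` with `K : Type u` in place
of `K : Type`). For a field `K` of characteristic `0` with derivations `D₁, …, D_m`, constants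
`C = ⋂ ker Dⱼ`, and `y, z : Fin n → K` with `zᵢ ≠ 0`, `Dⱼ zᵢ = zᵢ Dⱼ yᵢ` for all `i, j`, and
`y₁, …, yₙ` `ℚ`-linearly independent modulo `C`:
`n + rank (Dⱼ yᵢ)ᵢⱼ ≤ trdeg_C C[y, z]`. Proof as in `Transcendental.ax_schanuel_of_rosenlicht`:
give `C` its field structure, view the `Dⱼ` as `C`-derivations (`toConstDerivation`) and apply
`add_rank_le_trdeg_of_field`. [cite: Ax1971, Thm. 3] -/
theorem add_rank_le_trdeg {K : Type u} [Field K] [CharZero K] {m n : ℕ}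
    (D : Fin m → Derivation ℤ K K) (y z : Fin n → K) (hz : ∀ i, z i ≠ 0)
    (hexp : ∀ j i, D j (z i) = z i * D j (y i)) (hind : IsQLinearIndependentMod D y) :
    ((n + (Matrix.of fun i j => D j (y i)).rank : ℕ) : Cardinal) ≤
      Algebra.trdeg (constantSubring D)
        (Algebra.adjoin (constantSubring D) (Set.range y ∪ Set.range z)) := by
  classical
  letI : Field (constantSubring D) := (isField_constantSubring D).toField
  haveI : CharZero (constantSubring D) := (algebraMap (constantSubring D) K).charZero
  have hC : ∀ x : K, (∀ j, toConstDerivation D j x = 0) →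
      x ∈ Set.range (algebraMap (constantSubring D) K) :=
    fun x hx => ⟨⟨x, fun j => hx j⟩, rfl⟩
  have hind' : ∀ q : Fin n → ℤ, (∀ j, toConstDerivation D j (∑ i, (q i : K) * y i) = 0) → q = 0 :=
    fun q hq => hind q fun j => hq j
  exact add_rank_le_trdeg_of_field (toConstDerivation D) hC y z hz (fun j i => hexp j i) hind'

end Literature.NumberTheory.Transcendental.Ax1971

end
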